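import Summits.KontsevichZagierPeriods.KontsevichZagierPeriods.Theorems.RootDecompWalshStrataHtypeConicEuler

/-!
# Root decomposition (Walsh strata), part 55 — H-type X: line-edge family, linear or constant radicand

The degenerate line-edge residual `R-HLx°` of part 53 consists of the members of the family

  `∫_S γ · Hi(x) · √P(x) · (κ₁ g − e κ₀ x)/H(x)² dx`,   `H = e x² + g`, `Hi = (e/3) x³ + g x`,
  `P = e′x² + f′x + g′`, `e′ = e − m κ₁²`, `f′ = −2 m κ₀ κ₁`, `g′ = g − m κ₀²`,

with `e′ (4 e′ g′ − f′²) = 0`.  This part closes the sub-family `e′ = 0` (so `κ₁² = e/m ≠ 0`):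

* `κ₀ ≠ 0`: the radicand `f′x + g′` is LINEAR with `f′ ≠ 0` — the LANDED `InBaker.linear_factor`
  (`x = (t² − g′)/f′` is a `ℚ`-rational chart; no hull condition, `H > 0` on the domain suffices);
* `κ₀ = 0`: the radicand is the CONSTANT `g`, and `S ≠ ∅` forces `g > 0`.  The integrand is
  `γ κ₁ g √g · x (H + 2g)/(3 H²)`; the chart `t = H(x) = e x² + g` (`x > 0`, `x dx = dt/(2e)`; rule (2), a
  `ℚ`-semialgebraic graph) turns it into `(c₁/t + c₂/t²) · √g` on a subset of `[g, e + g]`, the sum of two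
  LANDED scaled poles `InBaker.sqrt_const_pole g 0 c₁`, `InBaker.sqrt_const_dpole g 0 c₂`
  (`c₁ = γκ₁g/(6e)`, `c₂ = γκ₁g²/(3e)`), peeled apart with `InBaker.of_sub'` and a bounded representation.

The chart is isolated as the callback lemma `InBaker.of_Hsq_chart` (§55.1), the engine of the remaining
perfect-square case as well.  The head becomes
`quadricBakerDescent_of_residuals₈ : R-HLx°° → R-HCx° → R-Eθ → QuadricBakerDescent`, where `R-HLx°°` is
`R-HLx°` restricted to `e′ ≠ 0` (hence `4e′g′ = f′²`: the PERFECT-SQUARE radicand `e′(x − ρ)²`,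
`ρ = mκ₀κ₁/e′ ∈ ℚ`; not done here).

References: [KontsevichZagier2001 §1.2 rules (1)–(3)], [BCR1998 §2.2].
-/

noncomputable section

open Set MeasureTheory MvPolynomial Literature.NumberTheory.Transcendental
open Literature.ModelTheory.ExponentialFields (IsSemialgebraic isSemialgebraic_univ isSemialgebraic_empty)
open Summit.KontsevichZagierPeriods.RootDecompWalshStrata.ConicDescent.VertexChart

namespace Summit.KontsevichZagierPeriods.RootDecompWalshStrata.ConicDescent.BallCube

/-! #### 55.1 The chart `t = e x² + g` on `x > 0` (rule (2)) -/

/-- The open half-line `{t > g}` of `ℝ¹` is `ℚ`-semialgebraic. [BCR1998 §2.2] -/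
private theorem isSemialgebraic_gt_const (g : ℚ) : IsSemialgebraic ℚ {t : Fin 1 → ℝ | (g : ℝ) < t 0} := by
  convert Literature.ModelTheory.ExponentialFields.isSemialgebraic_setOf_eval_pos (k := ℚ) (R := ℝ)
    (MvPolynomial.X (0 : Fin 1) - MvPolynomial.C g : MvPolynomial (Fin 1) ℚ) using 1
  ext v
  simp only [mem_setOf_eq, map_sub, MvPolynomial.aeval_X, MvPolynomial.aeval_C, eq_ratCast, sub_pos]

/-- **The chart `t = e x² + g`** (`e > 0`, on `x > 0`; `x = √((t − g)/e)`, `x dx = dt/(2e)`), callback form: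
an integrand `2e · x · F(e x² + g)` on a domain inside `{x > 0}` pulls back (rule (2); the graph
`t = e x² + g, x > 0` is `ℚ`-semialgebraic) to `F(t)` on the corresponding subset of `{t > g}`.
[KontsevichZagier2001 §1.2 rule (2); this node] -/
theorem InBaker.of_Hsq_chart (e g : ℚ) (he : 0 < e) (r : KZ.IntegralRep 1)
    (hpos : ∀ v ∈ r.domain, 0 < v 0) (F : (Fin 1 → ℝ) → ℝ)
    (hF : IsSemialgebraicFunOn ℚ {t : Fin 1 → ℝ | (g : ℝ) < t 0} F)
    (hr : EqOn r.integrand (fun v => 2 * (e : ℝ) * v 0 * F (fun _ => (e : ℝ) * v 0 ^ 2 + g)) r.domain)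
    (h : ∀ r₁ : KZ.IntegralRep 1,
      r₁.domain = {t | t ∈ {t : Fin 1 → ℝ | (g : ℝ) < t 0} ∧
        lift₁ (fun s => √((s - g) / e)) t ∈ r.domain} →
      r₁.integrand = F → InBaker (KZ.of r₁)) :
    InBaker (KZ.of r) := by
  have he0 : (0 : ℝ) < e := by exact_mod_cast he
  have hT₀ := isSemialgebraic_gt_const g
  have hψ : IsRatOn {t : Fin 1 → ℝ | (g : ℝ) < t 0} fun t => (t 0 - g) / e :=
    (IsRatOn.coord.sub (IsRatOn.const g)).div (IsRatOn.const e) fun _ _ => he0.ne'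
  have hψpos : ∀ t ∈ {t : Fin 1 → ℝ | (g : ℝ) < t 0}, 0 < (t 0 - g) / e := fun t ht =>
    div_pos (sub_pos.2 ht) he0
  refine InBaker.of_cov₁' r hT₀ (fun s => √((s - g) / e))
    (fun s => 1 / (e : ℝ) / (2 * √((s - g) / e))) ?_ ?_ ?_ ?_ F hF ?_ h
  · exact IsSemialgebraicFunOn.sqrt_holds (hψ.isSemialgebraicFunOn hT₀)
  · intro t ht
    exact (((hasDerivAt_id' (t 0)).sub_const (g : ℝ)).div_const (e : ℝ)).sqrt (hψpos t ht).ne'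
  · intro s hs t ht hst
    have hst' : √((s 0 - g) / e) = √((t 0 - g) / e) := hst
    have h2 : (s 0 - g) / e = (t 0 - g) / e := by
      rw [← Real.sq_sqrt (hψpos s hs).le, ← Real.sq_sqrt (hψpos t ht).le, hst']
    have h3 := (div_left_inj' he0.ne').1 h2
    linarith
  · intro x hx
    have hx0 := hpos x hx
    refine ⟨fun _ => (e : ℝ) * x 0 ^ 2 + g, ?_, ?_⟩
    · show (g : ℝ) < (e : ℝ) * x 0 ^ 2 + g
      exact lt_add_of_pos_left _ (mul_pos he0 (pow_pos hx0 2))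
    · show √(((e : ℝ) * x 0 ^ 2 + g - g) / e) = x 0
      rw [add_sub_cancel_right, mul_div_cancel_left₀ _ he0.ne', Real.sqrt_sq hx0.le]
  · intro t ht htd
    have hw : 0 < √((t 0 - g) / e) := Real.sqrt_pos.2 (hψpos t ht)
    have hw2 : (e : ℝ) * √((t 0 - g) / e) ^ 2 + g = t 0 := by
      rw [Real.sq_sqrt (hψpos t ht).le, mul_div_cancel₀ _ he0.ne', sub_add_cancel]
    have ht' : (fun _ : Fin 1 => (e : ℝ) * √((t 0 - g) / e) ^ 2 + g) = t := by
      funext i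
      rw [hw2, Fin.eq_zero i]
    have hc : 2 * (e : ℝ) * √((t 0 - g) / e) * (1 / (e : ℝ) / (2 * √((t 0 - g) / e))) = 1 := by
      field_simp
    rw [hr htd]
    simp only [lift₁_apply]
    rw [ht', abs_of_pos (by positivity : (0 : ℝ) < 1 / (e : ℝ) / (2 * √((t 0 - g) / e))),
      mul_comm (2 * (e : ℝ) * √((t 0 - g) / e)) (F t), mul_assoc, hc, mul_one]

/-! #### 55.2 The linear radicand (`e = mκ₁²`, `κ₀ ≠ 0`) -/

/-- **Line-edge family, LINEAR radicand.**  If `e = m κ₁²` and `κ₀ ≠ 0` the radicand is `f′x + g′` with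
`f′ = −2mκ₀κ₁ ≠ 0`, and the integrand `hLxN/H² · √(f′x + g′)` is a `linear_factor` terminal (`H > 0` on
the domain).  [KontsevichZagier2001 §1.2 rule (2); Euler 1768; this node] -/
theorem InBaker.of_HLx_linear (e g m γ k0 k1 : ℚ) (he : 0 < e) (hm : 1 ≤ m)
    (h0 : e - m * k1 ^ 2 = 0) (hk0 : k0 ≠ 0)
    (S : Set (Fin 1 → ℝ)) (hS : IsSemialgebraic ℚ S)
    (hdom : ∀ t ∈ S, (0 ≤ t 0 ∧ t 0 ≤ 1) ∧ 0 < (e : ℝ) * t 0 ^ 2 + g ∧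
      (m : ℝ) * ((k0 : ℝ) + k1 * t 0) ^ 2 < (e : ℝ) * t 0 ^ 2 + g)
    (r : KZ.IntegralRep 1) (hrd : r.domain = S)
    (hri : EqOn r.integrand (fun t => (γ : ℝ) * ((e : ℝ) / 3 * t 0 ^ 3 + g * t 0) *
      √((e : ℝ) * t 0 ^ 2 + g - m * ((k0 : ℝ) + k1 * t 0) ^ 2) *
      (((k1 : ℝ) * g - e * k0 * t 0) / ((e : ℝ) * t 0 ^ 2 + g) ^ 2)) S) :
    InBaker (KZ.of r) := by
  have _hS := hS
  subst hrd
  have hm0 : 0 < m := zero_lt_one.trans_le hm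
  have hk1 : k1 ≠ 0 := by
    rintro rfl
    simp at h0
    exact he.ne' h0
  have hf : -(2 * m * k0 * k1) ≠ 0 :=
    neg_ne_zero.2 (mul_ne_zero (mul_ne_zero (mul_ne_zero two_ne_zero hm0.ne') hk0) hk1)
  refine InBaker.linear_factor (-(2 * m * k0 * k1)) (g - m * k0 ^ 2) hf (hLxN e g γ k0 k1) (hP e g ^ 2) r
    (fun v hv => ?_) fun v hv => ?_
  · rw [map_pow, aeval_hP]
    exact pow_ne_zero 2 (hdom v hv).2.1.ne'
  · rw [hri hv]
    dsimp only
    rw [hLx_rad, h0, aeval_hLxN, map_pow, aeval_hP]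
    ring

/-! #### 55.3 The constant radicand (`e = mκ₁²`, `κ₀ = 0`): the chart `t = H` and two scaled poles -/

/-- **Line-edge family, CONSTANT radicand.**  If `e = m κ₁²` and `κ₀ = 0` the radicand is the constant
`g`; a non-empty domain forces `g > 0`, and `γκ₁g√g · x(H + 2g)/(3H²) dx` is, in the chart `t = H`
(`InBaker.of_Hsq_chart`), `(c₁/t + c₂/t²)·√g dt` on a subset of `(g, e + g]`: the sum of the LANDED scaled
poles `sqrt_const_pole g 0 c₁` and `sqrt_const_dpole g 0 c₂`.  [KontsevichZagier2001 §1.2 rules (1)–(3);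
this node] -/
theorem InBaker.of_HLx_const (e g m γ k0 k1 : ℚ) (he : 0 < e) (hm : 1 ≤ m)
    (h0 : e - m * k1 ^ 2 = 0) (hk0 : k0 = 0)
    (S : Set (Fin 1 → ℝ)) (hS : IsSemialgebraic ℚ S)
    (hdom : ∀ t ∈ S, (0 ≤ t 0 ∧ t 0 ≤ 1) ∧ 0 < (e : ℝ) * t 0 ^ 2 + g ∧
      (m : ℝ) * ((k0 : ℝ) + k1 * t 0) ^ 2 < (e : ℝ) * t 0 ^ 2 + g)
    (r : KZ.IntegralRep 1) (hrd : r.domain = S)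
    (hri : EqOn r.integrand (fun t => (γ : ℝ) * ((e : ℝ) / 3 * t 0 ^ 3 + g * t 0) *
      √((e : ℝ) * t 0 ^ 2 + g - m * ((k0 : ℝ) + k1 * t 0) ^ 2) *
      (((k1 : ℝ) * g - e * k0 * t 0) / ((e : ℝ) * t 0 ^ 2 + g) ^ 2)) S) :
    InBaker (KZ.of r) := by
  have _hS := hS
  have _hm := hm
  subst hrd
  subst hk0
  have he0 : (0 : ℝ) < e := by exact_mod_cast he
  have hem : (m : ℝ) * k1 ^ 2 = e := by
    have h1 : ((e - m * k1 ^ 2 : ℚ) : ℝ) = 0 := by rw [h0, Rat.cast_zero]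
    push_cast at h1
    linarith
  have hrad : ∀ x : ℝ, (e : ℝ) * x ^ 2 + g - m * (((0 : ℚ) : ℝ) + k1 * x) ^ 2 = g := fun x => by
    push_cast
    linear_combination (-(x ^ 2)) * hem
  rcases lt_or_ge 0 g with hg | hg
  swap
  · -- `g ≤ 0`: the domain is empty
    refine InBaker.of_domain_eq_empty r (Set.eq_empty_of_subset_empty fun v hv => ?_)
    exfalso
    obtain ⟨-, -, h3⟩ := hdom v hv
    have hg0 : (g : ℝ) ≤ 0 := by exact_mod_cast hg
    have h4 : (e : ℝ) * v 0 ^ 2 + g - m * (((0 : ℚ) : ℝ) + k1 * v 0) ^ 2 ≤ 0 := by rw [hrad]; exact hg0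
    linarith
  · have hg0 : (0 : ℝ) < g := by exact_mod_cast hg
    obtain ⟨c₁, hc₁⟩ : ∃ c₁ : ℚ, c₁ = γ * k1 * g / (6 * e) := ⟨_, rfl⟩
    obtain ⟨c₂, hc₂⟩ : ∃ c₂ : ℚ, c₂ = γ * k1 * g ^ 2 / (3 * e) := ⟨_, rfl⟩
    refine InBaker.of_split_at 0 r (fun r₁ hd₁ hi₁ => ?_) fun r₁ hd₁ hi₁ => ?_
    · -- `x > 0`: the chart `t = H`
      have hpos : ∀ v ∈ r₁.domain, 0 < v 0 := fun v hv => by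
        rw [hd₁] at hv
        have h2 : ((0 : ℚ) : ℝ) < v 0 := hv.2
        rwa [Rat.cast_zero] at h2
      have hT := isSemialgebraic_gt_const g
      have hne : ∀ t ∈ {t : Fin 1 → ℝ | (g : ℝ) < t 0}, t 0 - ((0 : ℚ) : ℝ) ≠ 0 := fun t ht => by
        have h2 : (g : ℝ) < t 0 := ht
        rw [Rat.cast_zero, sub_zero]
        exact (hg0.trans h2).ne'
      refine InBaker.of_Hsq_chart e g he r₁ hpos
        (fun t => (c₁ : ℝ) / (t 0 - ((0 : ℚ) : ℝ)) * √(qD 0 0 g (t 0)) +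
          (c₂ : ℝ) / (t 0 - ((0 : ℚ) : ℝ)) ^ 2 * √(qD 0 0 g (t 0))) ?_ (fun v hv => ?_)
        fun r₂ hd₂ hi₂ => ?_
      · -- semialgebraic on `{t > g}`
        have hA : IsRatOn {t : Fin 1 → ℝ | (g : ℝ) < t 0} fun t => (c₁ : ℝ) / (t 0 - ((0 : ℚ) : ℝ)) :=
          (IsRatOn.const c₁).div (IsRatOn.coord.sub (IsRatOn.const 0)) hne
        have hB : IsRatOn {t : Fin 1 → ℝ | (g : ℝ) < t 0}
            fun t => (c₂ : ℝ) / (t 0 - ((0 : ℚ) : ℝ)) ^ 2 :=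
          (IsRatOn.const c₂).div ((IsRatOn.coord.sub (IsRatOn.const 0)).pow 2) fun t ht =>
            pow_ne_zero 2 (hne t ht)
        have hsq := IsSemialgebraicFunOn.sqrt_holds (isSemialgebraicFunOn_qD 0 0 g hT)
        exact (((hA.isSemialgebraicFunOn hT).mul_holds hsq).add_holds
          ((hB.isSemialgebraicFunOn hT).mul_holds hsq)).congr fun t _ => by
            simp only [Pi.add_apply, Pi.mul_apply]
      · -- the integrand in the chart
        have hv1 : v ∈ r.domain := by rw [hd₁] at hv; exact hv.1
        have hx := hpos v hv
        obtain ⟨-, hH, -⟩ := hdom v hv1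
        have hH0 := hH.ne'
        have hqD : qD 0 0 g ((e : ℝ) * v 0 ^ 2 + g) = g := by simp [qD]
        rw [hi₁, hri hv1]
        dsimp only
        rw [hrad, hqD, hc₁, hc₂]
        push_cast
        field_simp
        ring
      · -- the pulled-back piece: two scaled poles at `t = 0` on a subset of `(g, e + g]`
        have hdg : ∀ t ∈ r₂.domain, (g : ℝ) < t 0 := fun t ht => by
          rw [hd₂] at ht; exact ht.1
        have hdle : ∀ t ∈ r₂.domain, t 0 ≤ (e : ℝ) + g := fun t ht => by
          rw [hd₂] at ht
          obtain ⟨ht1, ht2⟩ := ht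
          have ht1' : (g : ℝ) < t 0 := ht1
          rw [hd₁] at ht2
          obtain ⟨⟨-, h1⟩, -⟩ := hdom _ ht2.1
          simp only [lift₁_apply] at h1
          have hp : 0 ≤ (t 0 - g) / e := (div_pos (sub_pos.2 ht1') he0).le
          have h2 : (t 0 - g) / e ≤ 1 := by
            nlinarith [Real.sqrt_nonneg ((t 0 - g) / e), Real.sq_sqrt hp]
          have h3 := (div_le_one he0).1 h2
          linarith
        have hb : Bornology.IsBounded r₂.domain := by
          refine isBounded_iff_forall_norm_le.2 ⟨(e : ℝ) + g, fun t ht => ?_⟩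
          refine (pi_norm_le_iff_of_nonneg (by positivity)).2 fun i => ?_
          rw [Fin.eq_zero i, Real.norm_eq_abs, abs_le]
          exact ⟨by linarith [hdg t ht], hdle t ht⟩
        have hne₂ : ∀ t ∈ r₂.domain, t 0 - ((0 : ℚ) : ℝ) ≠ 0 := fun t ht => hne t (hdg t ht)
        have hfA : IsSemialgebraicFunOn ℚ r₂.domain
            fun t => (c₁ : ℝ) / (t 0 - ((0 : ℚ) : ℝ)) * √(qD 0 0 g (t 0)) :=
          ((((IsRatOn.const c₁).div (IsRatOn.coord.sub (IsRatOn.const 0)) hne₂).isSemialgebraicFunOn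
            r₂.isSemialgebraic_domain).mul_holds (IsSemialgebraicFunOn.sqrt_holds
              (isSemialgebraicFunOn_qD 0 0 g r₂.isSemialgebraic_domain))).congr fun t _ => by
            simp only [Pi.mul_apply]
        have hM : ∀ t ∈ r₂.domain,
            |(c₁ : ℝ) / (t 0 - ((0 : ℚ) : ℝ)) * √(qD 0 0 g (t 0))| ≤ |(c₁ : ℝ)| / g * √g := by
          intro t ht
          have htg := hdg t ht
          have ht0 : 0 < t 0 := hg0.trans htg
          have hqD : qD 0 0 g (t 0) = g := by simp [qD]
          rw [hqD, Rat.cast_zero, sub_zero, abs_mul, abs_div, abs_of_pos ht0,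
            abs_of_nonneg (Real.sqrt_nonneg _)]
          exact mul_le_mul_of_nonneg_right (div_le_div_of_nonneg_left (abs_nonneg _) hg0 htg.le)
            (Real.sqrt_nonneg _)
        refine InBaker.of_sub' r₂ (bddRep r₂.domain r₂.isSemialgebraic_domain hb _ hfA _ hM) rfl
          (InBaker.sqrt_const_pole g 0 c₁ hg _ fun t _ => rfl) ?_
        refine InBaker.sqrt_const_dpole g 0 c₂ hg _ fun t _ => ?_
        show r₂.integrand t - (c₁ : ℝ) / (t 0 - ((0 : ℚ) : ℝ)) * √(qD 0 0 g (t 0)) = _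
        rw [hi₂]
        ring
    · -- `x < 0`: empty
      refine InBaker.of_domain_eq_empty r₁ ?_
      rw [hd₁]
      refine Set.eq_empty_of_subset_empty fun v hv => ?_
      exfalso
      obtain ⟨⟨h00, -⟩, -⟩ := hdom v hv.1
      have h2 : v 0 < ((0 : ℚ) : ℝ) := hv.2
      rw [Rat.cast_zero] at h2
      linarith

/-! #### 55.4 Dispatcher and head -/

/-- **`R-HLx°° → R-HLx°`**: the degenerate line-edge family with `e′ = 0` is closed by `of_HLx_linear`
(`κ₀ ≠ 0`) and `of_HLx_const` (`κ₀ = 0`); the PERFECT-SQUARE radicands (`e′ ≠ 0`, `4e′g′ = f′²`) remain.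
[this node] -/
theorem InBaker.of_Hlines_xd
    (hdeg : (∀ (e g m γ k0 k1 : ℚ), 0 < e → 1 ≤ m → e - m * k1 ^ 2 ≠ 0 →
      (e - m * k1 ^ 2) * (4 * (e - m * k1 ^ 2) * (g - m * k0 ^ 2) - (2 * m * k0 * k1) ^ 2) = 0 →
      ∀ (S : Set (Fin 1 → ℝ)), IsSemialgebraic ℚ S →
        (∀ t ∈ S, (0 ≤ t 0 ∧ t 0 ≤ 1) ∧ 0 < (e : ℝ) * t 0 ^ 2 + g ∧
          (m : ℝ) * ((k0 : ℝ) + k1 * t 0) ^ 2 < (e : ℝ) * t 0 ^ 2 + g) →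
        ∀ r : KZ.IntegralRep 1, r.domain = S →
          EqOn r.integrand (fun t => (γ : ℝ) * ((e : ℝ) / 3 * t 0 ^ 3 + g * t 0) *
            √((e : ℝ) * t 0 ^ 2 + g - m * ((k0 : ℝ) + k1 * t 0) ^ 2) *
            (((k1 : ℝ) * g - e * k0 * t 0) / ((e : ℝ) * t 0 ^ 2 + g) ^ 2)) S →
          InBaker (KZ.of r))) :
    (∀ (e g m γ k0 k1 : ℚ), 0 < e → 1 ≤ m →
      (e - m * k1 ^ 2) * (4 * (e - m * k1 ^ 2) * (g - m * k0 ^ 2) - (2 * m * k0 * k1) ^ 2) = 0 →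
      ∀ (S : Set (Fin 1 → ℝ)), IsSemialgebraic ℚ S →
        (∀ t ∈ S, (0 ≤ t 0 ∧ t 0 ≤ 1) ∧ 0 < (e : ℝ) * t 0 ^ 2 + g ∧
          (m : ℝ) * ((k0 : ℝ) + k1 * t 0) ^ 2 < (e : ℝ) * t 0 ^ 2 + g) →
        ∀ r : KZ.IntegralRep 1, r.domain = S →
          EqOn r.integrand (fun t => (γ : ℝ) * ((e : ℝ) / 3 * t 0 ^ 3 + g * t 0) *
            √((e : ℝ) * t 0 ^ 2 + g - m * ((k0 : ℝ) + k1 * t 0) ^ 2) *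
            (((k1 : ℝ) * g - e * k0 * t 0) / ((e : ℝ) * t 0 ^ 2 + g) ^ 2)) S →
          InBaker (KZ.of r)) := by
  intro e g m γ k0 k1 he hm hdisc S hS hdom r hrd hri
  by_cases h0 : e - m * k1 ^ 2 = 0
  · by_cases hk0 : k0 = 0
    · exact InBaker.of_HLx_const e g m γ k0 k1 he hm h0 hk0 S hS hdom r hrd hri
    · exact InBaker.of_HLx_linear e g m γ k0 k1 he hm h0 hk0 S hS hdom r hrd hri
  · exact hdeg e g m γ k0 k1 he hm h0 hdisc S hS hdom r hrd hri

/-! #### 55.5 Head -/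

/-- **`QuadricBakerDescent` from three typed residuals, v8.**  As `quadricBakerDescent_of_residuals₇`
(part 54) with the line-edge residual shrunk to `R-HLx°°` = the PERFECT-SQUARE radicands
(`e′ = e − mκ₁² ≠ 0`, `4e′g′ = f′²`, i.e. `P = e′(x − ρ)²`, `ρ = mκ₀κ₁/e′ ∈ ℚ`) of the line-edge family;
the linear and constant radicands are closed in this part.  [KontsevichZagier2001 §1.2; this node] -/
theorem quadricBakerDescent_of_residuals₈
    (hx : (∀ (e g m γ k0 k1 : ℚ), 0 < e → 1 ≤ m → e - m * k1 ^ 2 ≠ 0 →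
      (e - m * k1 ^ 2) * (4 * (e - m * k1 ^ 2) * (g - m * k0 ^ 2) - (2 * m * k0 * k1) ^ 2) = 0 →
      ∀ (S : Set (Fin 1 → ℝ)), IsSemialgebraic ℚ S →
        (∀ t ∈ S, (0 ≤ t 0 ∧ t 0 ≤ 1) ∧ 0 < (e : ℝ) * t 0 ^ 2 + g ∧
          (m : ℝ) * ((k0 : ℝ) + k1 * t 0) ^ 2 < (e : ℝ) * t 0 ^ 2 + g) →
        ∀ r : KZ.IntegralRep 1, r.domain = S →
          EqOn r.integrand (fun t => (γ : ℝ) * ((e : ℝ) / 3 * t 0 ^ 3 + g * t 0) *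
            √((e : ℝ) * t 0 ^ 2 + g - m * ((k0 : ℝ) + k1 * t 0) ^ 2) *
            (((k1 : ℝ) * g - e * k0 * t 0) / ((e : ℝ) * t 0 ^ 2 + g) ^ 2)) S →
          InBaker (KZ.of r)))
    (hc : (∀ (e g m γ q0 q1 q2 s : ℚ), 0 < e → 1 ≤ m → (s = 1 ∨ s = -1) →
      ((m + q2 ^ 2) * e - m * q1 ^ 2) *
          (4 * ((m + q2 ^ 2) * e - m * q1 ^ 2) * ((m + q2 ^ 2) * g - m * q0 ^ 2) - (2 * m * q0 * q1) ^ 2) = 0 →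
      ∀ (S : Set (Fin 1 → ℝ)), IsSemialgebraic ℚ S →
        (∀ t ∈ S, (0 ≤ t 0 ∧ t 0 ≤ 1) ∧ 0 < (e : ℝ) * t 0 ^ 2 + g ∧
          0 < ((m : ℝ) + q2 ^ 2) * ((e : ℝ) * t 0 ^ 2 + g) - m * ((q0 : ℝ) + q1 * t 0) ^ 2) →
        ∀ r : KZ.IntegralRep 1, r.domain = S →
          EqOn r.integrand (fun t => (γ : ℝ) * ((e : ℝ) / 3 * t 0 ^ 3 + g * t 0) * ((q1 : ℝ) * g - e * q0 * t 0) *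
            ((m : ℝ) * ((q0 : ℝ) + q1 * t 0) +
              s * q2 * √(((m : ℝ) + q2 ^ 2) * ((e : ℝ) * t 0 ^ 2 + g) - m * ((q0 : ℝ) + q1 * t 0) ^ 2)) ^ 2 /
            (((e : ℝ) * t 0 ^ 2 + g) ^ 2 *
              √(((m : ℝ) + q2 ^ 2) * ((e : ℝ) * t 0 ^ 2 + g) - m * ((q0 : ℝ) + q1 * t 0) ^ 2))) S →
          InBaker (KZ.of r)))
    (hθ : (∀ (L : Quadric₃) (ℓ₁ ℓ₂ g : Wall) (γ : ℚ) (σ : Fin 6 → SignType) (r : KZ.IntegralRep 2),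
      0 < L.dq.disc →
      ¬((L.bwall ℓ₁).precomp L.dq.lagM.inv ∈ goodWalls 1 L.dq.eκ L.dq.d11 L.dq.cst ∧
          (L.bwall ℓ₂).precomp L.dq.lagM.inv ∈ goodWalls 1 L.dq.eκ L.dq.d11 L.dq.cst) →
      r.domain = atomFam (L.wfam ℓ₁ ℓ₂ g) σ →
      EqOn r.integrand (fun v => (γ : ℝ) * √(L.Dxy (v 0) (v 1))) r.domain → InBaker (KZ.of r))) :
    Summit.KontsevichZagierPeriods.KontsevichZagierPeriods.Theses.RootDecompWalshStrata.QuadricBakerDescent :=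
  quadricBakerDescent_of_residuals₇ (InBaker.of_Hlines_xd hx) hc hθ

end Summit.KontsevichZagierPeriods.RootDecompWalshStrata.ConicDescent.BallCube
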